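import Mathlib
import Summits.Ventures.PercRepro2.TypedORootEdge
import Summits.Ventures.PercRepro2.TypedOEdgeTypeTwo

/-!
# The root edge at a degree-two `o`: the `(2, 1)` base is the `(1, 1)` base plus the contraction
(blind cell PercRepro2, night-3 g17, 2026-08-27; NIGHT3-CERT.md §26.10)

With `e = {o, u}` and `f = {o, a₁}` of type `1` the only typed edges at `o`: «type 2 = type 1 +
pinned open − deleted» at `e` (`typedCount_o_edge_type_two`) has a vanishing deleted term (`o`
pendant at the root, `typedCount_o_pendant_root`), so

  `N(τ[e := 2]) = N(τ[e := 1]) + N(τ[e := 3])`   (`typedCount_o_root_edge_two_one`),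

the second term being the count with `e` pinned open — `o` contracted into `u`, an instance with one
typed edge fewer.  Hence row 2′TRI at the `(2, 1)` instance follows from the `(1, 1)` instance and
the smaller one (`typedCount_nonneg_o_root_two_one`).  Own work; standard axioms.
-/

namespace Summit.Ventures.PercRepro2

namespace CovForm

namespace TypedRed

open OneTyped

section Main

open Classical

variable {V : Type*} {E : Type*} [Fintype E] [DecidableEq E] {R : Type*} [Field R]
  [LinearOrder R] [IsStrictOrderedRing R]

variable (ends : E → Sym2 V) (o a₁ a₂ a₃ b : V)

/-- **The split at the `U`-edge**: `N(τ[e := 2]) = N(τ[e := 1]) + N(τ[e := 3])` for `e = {o, u}` and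
`f = {o, a₁}` of type `1` the only typed edges at `o`. -/
theorem typedCount_o_root_edge_two_one {e f : E} {u : V} (he : ends e = s(o, u))
    (hf : ends f = s(o, a₁)) (hou : o ≠ u) (hef : e ≠ f) (ho1 : o ≠ a₁) (ho2 : o ≠ a₂)
    (ho3 : o ≠ a₃) (hob : o ≠ b) (F : Finset E) (heF : e ∈ F) (hfF : f ∈ F) (z : Config E)
    (τ : E → ℕ) (hτf : τ f = 1)
    (hcl : ∀ e', e' ≠ e → e' ≠ f → o ∈ ends e' → e' ∉ F ∧ z e' = false) :
    typedCount F z (Function.update τ e 2)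
        (K3 ends o a₁ a₂ a₃ b : Config E → Config E → Config E → R) =
      typedCount F z (Function.update τ e 1) (K3 ends o a₁ a₂ a₃ b) +
        typedCount F z (Function.update τ e 3) (K3 ends o a₁ a₂ a₃ b) := by
  have h := typedCount_o_edge_type_two (R := R) ends o a₁ a₂ a₃ b he hou hef ho1 ho2 ho3 hob F heF
    hfF z τ hτf hcl
  -- the deleted term: `o` pendant at the root
  have h0 : typedCount F z (Function.update τ e 0)
      (K3 ends o a₁ a₂ a₃ b : Config E → Config E → Config E → R) = 0 := by
    rw [typedCount_type_zero F e heF z _ (Function.update_self _ _ _)]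
    refine typedCount_o_pendant_root ends o a₁ a₂ a₃ b hf ho1 ho2 ho3 hob (F.erase e)
      (Finset.mem_erase.2 ⟨hef.symm, hfF⟩) _ _ ?_ ?_
    · rw [Function.update_of_ne hef.symm, hτf]
    · intro e' hf' ho
      by_cases he' : e' = e
      · subst he'
        exact ⟨Finset.notMem_erase e' F, Function.update_self _ _ _⟩
      · obtain ⟨h1, h2⟩ := hcl e' he' hf' ho
        exact ⟨fun h => h1 (Finset.mem_of_mem_erase h), by rw [Function.update_of_ne he']; exact h2⟩
  rw [h0] at h
  linarith

/-- **Row 2′TRI at the `(2, 1)` instance of a root edge from the `(1, 1)` instance and the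
contraction `o := u`.** -/
theorem typedCount_nonneg_o_root_two_one {e f : E} {u : V} (he : ends e = s(o, u))
    (hf : ends f = s(o, a₁)) (hou : o ≠ u) (hef : e ≠ f) (ho1 : o ≠ a₁) (ho2 : o ≠ a₂)
    (ho3 : o ≠ a₃) (hob : o ≠ b) (F : Finset E) (heF : e ∈ F) (hfF : f ∈ F) (z : Config E)
    (τ : E → ℕ) (hτf : τ f = 1)
    (hcl : ∀ e', e' ≠ e → e' ≠ f → o ∈ ends e' → e' ∉ F ∧ z e' = false)
    (h1 : 0 ≤ typedCount F z (Function.update τ e 1)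
      (K3 ends o a₁ a₂ a₃ b : Config E → Config E → Config E → R))
    (h3 : 0 ≤ typedCount F z (Function.update τ e 3)
      (K3 ends o a₁ a₂ a₃ b : Config E → Config E → Config E → R)) :
    0 ≤ typedCount F z (Function.update τ e 2)
      (K3 ends o a₁ a₂ a₃ b : Config E → Config E → Config E → R) := by
  rw [typedCount_o_root_edge_two_one ends o a₁ a₂ a₃ b he hf hou hef ho1 ho2 ho3 hob F heF hfF z τ
    hτf hcl]
  exact add_nonneg h1 h3

end Main

end TypedRed

end CovForm

end Summit.Ventures.PercRepro2
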